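import Summits.QuantumFields.BalabanUV.Gaps.CapTailPinnedLimitSign
import Summits.QuantumFields.BalabanUV.Beta.RemainderThresholdSharp

/-!
# `BalabanUV.Gaps.D1PinnedNumeral` — cell pub-balaban-gaps, row (D1), seat g1-p1: AT THE β-LEAD's PINNED LITERAL `JsBalAn1` THE BINDER (D1) HAS
# EXACTLY ONE FREE REAL PARAMETER — the colour numeral — AND THE LITERAL DETERMINES IT: (D1) holds for SOME numeral iff `0 ≤ lim β⁰`, then for the
# UNIQUE `N ≥ 0` with `(11N²∕12π²)·log Lc = lim β⁰`, namely `N_eff := √(12π²·lim β⁰ ∕ (11·log Lc))`; and the END's β⁰-side bit `0 < lim β⁰`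
# (g1-p3 `CapTailPinnedLimitSign` §2∕§4) IS «(D1) for SOME numeral `N > 0`» — the VALUE `11N²∕12π²` of [I] (0.20) enters the headline only through
# the dictionary that equates `N_eff` with the construction's `N`.

HONEST FRAMING (cell rule, page 1 of everything): bookkeeping over the tree's HYPOTHESIS-FREE all-scales rate for the pinned literal
(gan24-p1 `GAN24.WSlotT2TablesAn1.allScalesSeq_secondMoment_JsBalAn1_pinned`) and g1-p3's scalar wall `CapTailPinnedLimitSign.d1Drift_pinned_iff_lim_eq`
(`D1Drift … N ↔ lim β⁰ = stepBal N Lc`), plus real algebra of the slope map `N ↦ stepBal N Lc = (11N²∕12π²)·log Lc` ([I] (0.20) p. 256, the tree's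
`B12Normalization.stepBal_eq`).  NOTHING of Bałaban's is asserted beyond print; [Balaban1987RG1] Thm 2 is UNPROVED IN PRINT; the family `JsBalAn1 …` does
NOT depend on the numeral `N` (the colour data `cE cVH cΛ cB Tc` are free reals ∕ a free table here), which is exactly why the numeral is a free
parameter of the binder at this literal; whether `N_eff` equals the construction's colour number is the IDENTIFICATION residual of row (D1) — OPEN,
not touched; `0 < lim β⁰` is NOT proved here (it is the wall in sign currency); 0 coefficients certified; (D1) NOT discharged at any literal; 0∕4
row-D1 binders; NOT `BetaPertH`, NOT the continuum limit, NOT Clay.  HONEST DEPENDENCY (b2b cell, verbatim): «continuum YM on T⁴ ⇐ BetaPertH ∧ nine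
spine estimates (0/9 proved); BetaPertH ⇐ (D1) ∧ (D4) ∧ CAP+tail; G-an2-4 gates asym, D1 and NE2/3/4.»

CONTENT (all [folklore]; no `def`, no `def … : Prop`, nothing cited as a hypothesis, 0 sorry).
* §1 real algebra of the slope map for `1 < L` (`0 ≤ stepBal N L` is the β sub-cell's `RemainderThresholdSharp.stepBal_nonneg`, imported): `stepBal_eq_iff_sq_eq`
  (`stepBal N L = ℓ ↔ N² = 12π²ℓ∕(11·log L)`), `stepBal_sqrt_eq` (`0 ≤ ℓ → stepBal √(12π²ℓ∕(11·log L)) L = ℓ`), `eq_sqrt_of_stepBal_eq`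
  (`0 ≤ N → stepBal N L = ℓ → N = √(12π²ℓ∕(11·log L))`), `stepBal_pos_iff` (`0 < stepBal N L ↔ N ≠ 0`).
* §2 at the pinned literal (`2 ≤ Lc`, root `r ∈ box 4 Lc`, any colour data, any channel), with `ℓ := CauchyRate.lim (j ↦ secondMoment (TbalOf Lc (JsBalAn1 …) j) μ ν)`:
  **`exists_numeral_iff_lim_nonneg`** (`(∃ N, D1Drift … N μ ν) ↔ 0 ≤ ℓ`), **`d1Drift_pinned_sqrt_of_lim_nonneg`** (`0 ≤ ℓ →` (D1) holds for
  `N_eff = √(12π²ℓ∕(11·log Lc))`), **`d1Drift_pinned_iff_eq_sqrt`** (`0 ≤ N → (D1Drift … N μ ν ↔ 0 ≤ ℓ ∧ N = N_eff)`),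
  **`existsUnique_numeral_of_lim_nonneg`** (`0 ≤ ℓ → ∃! N, 0 ≤ N ∧ D1Drift … N μ ν`), **`exists_pos_numeral_iff_lim_pos`**
  (`(∃ N, 0 < N ∧ D1Drift … N μ ν) ↔ 0 < ℓ`), and the END reading **`endpointExistence_of_exists_pos_numeral`** (g1-p3's
  `endpointExistence_of_D1Drift_pinned_viaSign` with the numeral existentially bound: the headline's β⁰-side input at this literal is (D1) for SOME
  positive numeral + the dictionary `hβ` + `EverySlope` + (U)∕(L)∕(C)).
* §3 (v1.2) the same four statements for ANY step family `Js` under an all-scales rate `AllScalesSeq (j ↦ β⁰_j) κ θ` (`0 ≤ θ < 1`) — the lead's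
  `HessKerDressedCauchy.d1Drift_iff_lim_eq` in place of the pinned one: `exists_numeral_iff_lim_nonneg_of_allScales`, `d1Drift_iff_eq_sqrt_of_allScales`,
  `existsUnique_numeral_of_allScales`, `exists_pos_numeral_iff_lim_pos_of_allScales` (asym1's `CauchyRate.lim_pos_of_drift_stepBal`); at the (III′)
  literal of record `hall` is row G-an2-4's deliverable (a HYPOTHESIS there, as in `Gaps/D1ValueSockets` §3).
READING (zero classification weight): at the pinned literal the VALUE content of (D1) — the printed one-loop number `11N²∕12π²` — is entirely the
statement `N_eff(JsBalAn1, μ, ν) = N`; the headline consumes only `N_eff > 0` (equivalently `0 < lim β⁰`); neither is proved anywhere in the tree.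

ABSOLUTE RULE (cell charter, verbatim): «No internally-minted statement may enter as a cited fact. Every hypothesis is either kernel-proved in this
package or a verbatim quotation of a PUBLISHED theorem with page reference. The manuscript(s) under audit are NOT citable for their own disputed
steps — they are the thing under adjudication; programme-internal (2001/route/tribunal) claims are never citable.»

Provenance: cell pub-balaban-gaps, seat g1-p1 GEN 8 (prover-pub-balaban-gaps-g1-p1-g8-0), 2026-08-23; imports g1-p3's `Gaps/CapTailPinnedLimitSign`
+ the β sub-cell's `Beta/RemainderThresholdSharp` (for `stepBal_nonneg`) ONLY (transitively gan24's rate, asym1's `RateCertificate`, the β sub-cell's `MixedJetTablesPlug.JsBalAn1`); every tree theorem used BY NAME; no existing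
file touched.
-/

namespace Summit.QuantumFields.BalabanUV.Gaps.D1PinnedNumeral

open Literature.MathematicalPhysics.QuantumFieldTheory.Balaban1983to89
open Literature.MathematicalPhysics.QuantumFieldTheory.Balaban1983to89.FlowStep
open Literature.MathematicalPhysics.QuantumFieldTheory.Balaban1983to89.FlowStepRuns
open Literature.MathematicalPhysics.QuantumFieldTheory.Balaban1983to89.DagBinding
open Literature.MathematicalPhysics.QuantumFieldTheory.Balaban1983to89.Beta
open Literature.MathematicalPhysics.QuantumFieldTheory.Balaban1983to89.Beta.RateCertificate (CauchyRate)
open Literature.MathematicalPhysics.QuantumFieldTheory.Balaban1983to89.Beta.OneStepKernelFamily (TbalOf D1Drift)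
open Literature.MathematicalPhysics.QuantumFieldTheory.Balaban1983to89.Beta.AffineAveraging (box)
open Summit.QuantumFields.BalabanUV.Gaps.CapSignsConstRoad (EverySlope)
open Summit.QuantumFields.BalabanUV.Beta.MixedJetTablesPlug (JsBalAn1)
open Summit.QuantumFields.BalabanUV.Beta.GAN24.StencilSlotOfE3 (one_le_of_two_le)
open Summit.QuantumFields.BalabanUV.Gaps.CapTailPinnedLimitSign (d1Drift_pinned_iff_lim_eq limPos_of_D1Drift_pinned
  endpointExistence_of_D1Drift_pinned_viaSign)
open Summit.QuantumFields.BalabanUV.Beta.RemainderThresholdSharp (stepBal_nonneg)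
open Real

noncomputable section

/-! ## §1 Real algebra of the slope map `N ↦ stepBal N L = (11N²∕12π²)·log L` -/

section Slope

/-- [folklore] For `1 < L`: `stepBal N L = ℓ ↔ N² = 12π²ℓ∕(11·log L)`. -/
theorem stepBal_eq_iff_sq_eq (N ℓ : ℝ) {L : ℝ} (hL : 1 < L) :
    B12Normalization.stepBal N L = ℓ ↔ N ^ 2 = 12 * π ^ 2 * ℓ / (11 * Real.log L) := by
  rw [B12Normalization.stepBal_eq]
  have hlog : 0 < Real.log L := Real.log_pos hL
  have hπ : 0 < π ^ 2 := by positivity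
  constructor
  · intro h
    rw [← h]
    field_simp
  · intro h
    rw [h]
    field_simp

/-- [folklore] For `1 < L` and `0 ≤ ℓ` the nonnegative root `√(12π²ℓ∕(11·log L))` has slope exactly `ℓ`. -/
theorem stepBal_sqrt_eq {ℓ L : ℝ} (hL : 1 < L) (hℓ : 0 ≤ ℓ) :
    B12Normalization.stepBal (Real.sqrt (12 * π ^ 2 * ℓ / (11 * Real.log L))) L = ℓ := by
  rw [stepBal_eq_iff_sq_eq _ _ hL]
  have hlog : 0 < Real.log L := Real.log_pos hL
  exact Real.sq_sqrt (by positivity)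

/-- [folklore] For `1 < L`, a NONNEGATIVE numeral with slope `ℓ` IS that root: `0 ≤ N → stepBal N L = ℓ → N = √(12π²ℓ∕(11·log L))`. -/
theorem eq_sqrt_of_stepBal_eq {N ℓ L : ℝ} (hL : 1 < L) (hN : 0 ≤ N) (h : B12Normalization.stepBal N L = ℓ) :
    N = Real.sqrt (12 * π ^ 2 * ℓ / (11 * Real.log L)) := by
  rw [stepBal_eq_iff_sq_eq _ _ hL] at h
  rw [← h, Real.sqrt_sq hN]

/-- [folklore] For `1 < L`: `0 < stepBal N L ↔ N ≠ 0`. -/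
theorem stepBal_pos_iff (N : ℝ) {L : ℝ} (hL : 1 < L) : 0 < B12Normalization.stepBal N L ↔ N ≠ 0 := by
  rw [B12Normalization.stepBal_eq]
  have hlog : 0 < Real.log L := Real.log_pos hL
  have hπ : 0 < π ^ 2 := by positivity
  constructor
  · intro h hN
    rw [hN] at h
    simp at h
  · intro hN
    have : 0 < N ^ 2 := by positivity
    positivity

end Slope

/-! ## §2 At the pinned literal: existence, the effective numeral, uniqueness, and the END's bit -/

section Pinned

variable {Lc : ℕ} [NeZero Lc]

/-- [folklore] **(D1) HOLDS AT THE PINNED LITERAL FOR SOME NUMERAL IFF THE COEFFICIENT LIMIT IS NONNEGATIVE**: `(∃ N, D1Drift Lc (JsBalAn1 …) N μ ν) ↔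
0 ≤ lim β⁰` — g1-p3's scalar wall `D1Drift … N ↔ lim = stepBal N Lc` plus `stepBal N Lc ≥ 0` ∕ the square root. -/
theorem exists_numeral_iff_lim_nonneg (hLc : 2 ≤ Lc) {r : Fin (3 + 1) → ℕ} (hr : r ∈ box (3 + 1) Lc) (cE cVH cΛ cB : ℝ)
    (Tc : Fin 4 → Fin 4 → Fin 4 → Fin 4 → ℝ) (μ ν : Fin 4) :
    (∃ N : ℝ, D1Drift Lc (JsBalAn1 (one_le_of_two_le hLc) hr cE cVH cΛ ((Lc : ℝ) ^ (2 * (3 + 1))) cB Tc) N μ ν) ↔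
      0 ≤ CauchyRate.lim (fun j => B12Beta.secondMoment
        (TbalOf Lc (JsBalAn1 (one_le_of_two_le hLc) hr cE cVH cΛ ((Lc : ℝ) ^ (2 * (3 + 1))) cB Tc) j) μ ν) := by
  have hLc1 : (1 : ℝ) < (Lc : ℝ) := by exact_mod_cast (lt_of_lt_of_le one_lt_two hLc)
  constructor
  · rintro ⟨N, hD⟩
    rw [(d1Drift_pinned_iff_lim_eq hLc hr cE cVH cΛ cB Tc μ ν N).mp hD]
    exact stepBal_nonneg N hLc1.le
  · intro hℓ
    exact ⟨_, (d1Drift_pinned_iff_lim_eq hLc hr cE cVH cΛ cB Tc μ ν _).mpr (stepBal_sqrt_eq hLc1 hℓ).symm⟩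

/-- [folklore] **THE EFFECTIVE NUMERAL INHABITS (D1)**: if `0 ≤ lim β⁰` then (D1) holds at the pinned literal for
`N_eff := √(12π²·lim β⁰ ∕ (11·log Lc))`. -/
theorem d1Drift_pinned_sqrt_of_lim_nonneg (hLc : 2 ≤ Lc) {r : Fin (3 + 1) → ℕ} (hr : r ∈ box (3 + 1) Lc) (cE cVH cΛ cB : ℝ)
    (Tc : Fin 4 → Fin 4 → Fin 4 → Fin 4 → ℝ) (μ ν : Fin 4)
    (hℓ : 0 ≤ CauchyRate.lim (fun j => B12Beta.secondMoment
        (TbalOf Lc (JsBalAn1 (one_le_of_two_le hLc) hr cE cVH cΛ ((Lc : ℝ) ^ (2 * (3 + 1))) cB Tc) j) μ ν)) :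
    D1Drift Lc (JsBalAn1 (one_le_of_two_le hLc) hr cE cVH cΛ ((Lc : ℝ) ^ (2 * (3 + 1))) cB Tc)
      (Real.sqrt (12 * π ^ 2 * CauchyRate.lim (fun j => B12Beta.secondMoment
        (TbalOf Lc (JsBalAn1 (one_le_of_two_le hLc) hr cE cVH cΛ ((Lc : ℝ) ^ (2 * (3 + 1))) cB Tc) j) μ ν) / (11 * Real.log Lc))) μ ν := by
  have hLc1 : (1 : ℝ) < (Lc : ℝ) := by exact_mod_cast (lt_of_lt_of_le one_lt_two hLc)
  exact (d1Drift_pinned_iff_lim_eq hLc hr cE cVH cΛ cB Tc μ ν _).mpr (stepBal_sqrt_eq hLc1 hℓ).symm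

/-- [folklore] **(D1) AT THE PINNED LITERAL FOR A NONNEGATIVE NUMERAL `N` ⟺ `0 ≤ lim β⁰ ∧ N = N_eff`** — the literal DETERMINES the numeral. -/
theorem d1Drift_pinned_iff_eq_sqrt (hLc : 2 ≤ Lc) {r : Fin (3 + 1) → ℕ} (hr : r ∈ box (3 + 1) Lc) (cE cVH cΛ cB : ℝ)
    (Tc : Fin 4 → Fin 4 → Fin 4 → Fin 4 → ℝ) (μ ν : Fin 4) {N : ℝ} (hN : 0 ≤ N) :
    D1Drift Lc (JsBalAn1 (one_le_of_two_le hLc) hr cE cVH cΛ ((Lc : ℝ) ^ (2 * (3 + 1))) cB Tc) N μ ν ↔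
      0 ≤ CauchyRate.lim (fun j => B12Beta.secondMoment
          (TbalOf Lc (JsBalAn1 (one_le_of_two_le hLc) hr cE cVH cΛ ((Lc : ℝ) ^ (2 * (3 + 1))) cB Tc) j) μ ν) ∧
        N = Real.sqrt (12 * π ^ 2 * CauchyRate.lim (fun j => B12Beta.secondMoment
          (TbalOf Lc (JsBalAn1 (one_le_of_two_le hLc) hr cE cVH cΛ ((Lc : ℝ) ^ (2 * (3 + 1))) cB Tc) j) μ ν) / (11 * Real.log Lc)) := by
  have hLc1 : (1 : ℝ) < (Lc : ℝ) := by exact_mod_cast (lt_of_lt_of_le one_lt_two hLc)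
  constructor
  · intro hD
    have hlim := (d1Drift_pinned_iff_lim_eq hLc hr cE cVH cΛ cB Tc μ ν N).mp hD
    refine ⟨?_, eq_sqrt_of_stepBal_eq hLc1 hN hlim.symm⟩
    rw [hlim]
    exact stepBal_nonneg N hLc1.le
  · rintro ⟨hℓ, hNeq⟩
    rw [hNeq]
    exact d1Drift_pinned_sqrt_of_lim_nonneg hLc hr cE cVH cΛ cB Tc μ ν hℓ

/-- [folklore] **UNIQUENESS OF THE NUMERAL**: if `0 ≤ lim β⁰` there is EXACTLY ONE `N ≥ 0` for which (D1) holds at the pinned literal. -/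
theorem existsUnique_numeral_of_lim_nonneg (hLc : 2 ≤ Lc) {r : Fin (3 + 1) → ℕ} (hr : r ∈ box (3 + 1) Lc) (cE cVH cΛ cB : ℝ)
    (Tc : Fin 4 → Fin 4 → Fin 4 → Fin 4 → ℝ) (μ ν : Fin 4)
    (hℓ : 0 ≤ CauchyRate.lim (fun j => B12Beta.secondMoment
        (TbalOf Lc (JsBalAn1 (one_le_of_two_le hLc) hr cE cVH cΛ ((Lc : ℝ) ^ (2 * (3 + 1))) cB Tc) j) μ ν)) :
    ∃! N : ℝ, 0 ≤ N ∧ D1Drift Lc (JsBalAn1 (one_le_of_two_le hLc) hr cE cVH cΛ ((Lc : ℝ) ^ (2 * (3 + 1))) cB Tc) N μ ν := by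
  refine ⟨_, ⟨Real.sqrt_nonneg _, d1Drift_pinned_sqrt_of_lim_nonneg hLc hr cE cVH cΛ cB Tc μ ν hℓ⟩, ?_⟩
  rintro N ⟨hN, hD⟩
  exact ((d1Drift_pinned_iff_eq_sqrt hLc hr cE cVH cΛ cB Tc μ ν hN).mp hD).2

/-- [folklore] **THE END's β⁰-SIDE BIT = «(D1) FOR SOME POSITIVE NUMERAL»**: `(∃ N, 0 < N ∧ D1Drift … N μ ν) ↔ 0 < lim β⁰` — the sign of the limit,
which is the β⁰-side input of END grade at this literal (`CapTailPinnedLimitSign.endpointExistence_of_pinned_limPos`), is (D1) with the numeral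
existentially bound and positive. -/
theorem exists_pos_numeral_iff_lim_pos (hLc : 2 ≤ Lc) {r : Fin (3 + 1) → ℕ} (hr : r ∈ box (3 + 1) Lc) (cE cVH cΛ cB : ℝ)
    (Tc : Fin 4 → Fin 4 → Fin 4 → Fin 4 → ℝ) (μ ν : Fin 4) :
    (∃ N : ℝ, 0 < N ∧ D1Drift Lc (JsBalAn1 (one_le_of_two_le hLc) hr cE cVH cΛ ((Lc : ℝ) ^ (2 * (3 + 1))) cB Tc) N μ ν) ↔
      0 < CauchyRate.lim (fun j => B12Beta.secondMoment
        (TbalOf Lc (JsBalAn1 (one_le_of_two_le hLc) hr cE cVH cΛ ((Lc : ℝ) ^ (2 * (3 + 1))) cB Tc) j) μ ν) := by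
  have hLc1 : (1 : ℝ) < (Lc : ℝ) := by exact_mod_cast (lt_of_lt_of_le one_lt_two hLc)
  constructor
  · rintro ⟨N, hN, hD⟩
    exact limPos_of_D1Drift_pinned hLc hr cE cVH cΛ cB Tc μ ν hN hD
  · intro hℓ
    refine ⟨_, ?_, d1Drift_pinned_sqrt_of_lim_nonneg hLc hr cE cVH cΛ cB Tc μ ν hℓ.le⟩
    have hlog : 0 < Real.log (Lc : ℝ) := Real.log_pos hLc1
    exact Real.sqrt_pos.mpr (by positivity)

/-- [folklore] **END GRADE FROM (D1) WITH THE NUMERAL EXISTENTIALLY BOUND** (g1-p3's `endpointExistence_of_D1Drift_pinned_viaSign`, `N` packed):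
`(∃ N > 0, D1Drift …)` + the dictionary `hβ` + `EverySlope` + (U)∕(L)∕(C) + forward generation ⟹ `EndpointExistence C`.  The printed value of the
numeral plays no role at this grade. [cite: Balaban1987RG1, Thm 2 p.259 (first sentence) and (1.22) p.264] -/
theorem endpointExistence_of_exists_pos_numeral (hLc : 2 ≤ Lc) {r : Fin (3 + 1) → ℕ} (hr : r ∈ box (3 + 1) Lc)
    (cE cVH cΛ cB : ℝ) (Tc : Fin 4 → Fin 4 → Fin 4 → Fin 4 → ℝ) (μ ν : Fin 4)
    (hD : ∃ N : ℝ, 0 < N ∧ D1Drift Lc (JsBalAn1 (one_le_of_two_le hLc) hr cE cVH cΛ ((Lc : ℝ) ^ (2 * (3 + 1))) cB Tc) N μ ν)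
    {β : HBeta} {C : B12.Construction} (hgen : ForwardGenerated C β) (S : B12Beta.OneLoopSplit β)
    (hβ : ∀ j, S.β0 j = B12Beta.secondMoment
        (TbalOf Lc (JsBalAn1 (one_le_of_two_le hLc) hr cE cVH cΛ ((Lc : ℝ) ^ (2 * (3 + 1))) cB Tc) j) μ ν)
    {γc β' : ℝ} (hrem : EverySlope S γc) (hup : BetaUpperH β' γc β) (hlo : ∀ k, ∀ v ∈ Box γc k, -β' ≤ β k v)
    (hcont : BetaContH γc β) : EndpointExistence C := by
  obtain ⟨N, hN, hD⟩ := hD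
  exact endpointExistence_of_D1Drift_pinned_viaSign hLc hr cE cVH cΛ cB Tc μ ν hN hD hgen S hβ hrem hup hlo hcont

end Pinned

/-! ## §3 (v1.2) The same at ANY step family under an all-scales rate — in particular the (III′) literal of record under row G-an2-4's `hall` -/

section AnyJs

open Literature.MathematicalPhysics.QuantumFieldTheory.Balaban1983to89.Beta.RemainderConstAllScales (AllScalesSeq)
open Literature.MathematicalPhysics.QuantumFieldTheory.Balaban1983to89.Beta.OneStepResolventKernel (JetData)
open Literature.MathematicalPhysics.QuantumFieldTheory.Balaban1983to89.Beta.HessKerDressedCauchy (d1Drift_iff_lim_eq)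

variable {Lc : ℕ} [NeZero Lc]

/-- [folklore] **ANY STEP FAMILY UNDER AN ALL-SCALES RATE (row G-an2-4's shape, `0 ≤ θ < 1`, `2 ≤ Lc`): (D1) holds for SOME numeral iff `0 ≤ lim β⁰`**
— the lead's `HessKerDressedCauchy.d1Drift_iff_lim_eq` (any `Js`) in place of g1-p3's pinned one; at the (III′) literal of record `hall` is row G-an2-4's
deliverable (a HYPOTHESIS there), at `JsBalAn1` it is gan24's theorem (§2). -/
theorem exists_numeral_iff_lim_nonneg_of_allScales (hLc : 2 ≤ Lc) (Js : ℕ → JetData 3 Lc) {μ ν : Fin 4} {κ θ : ℝ}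
    (hall : AllScalesSeq (fun j => B12Beta.secondMoment (TbalOf Lc Js j) μ ν) κ θ) (hθ0 : 0 ≤ θ) (hθ1 : θ < 1) :
    (∃ N : ℝ, D1Drift Lc Js N μ ν) ↔ 0 ≤ CauchyRate.lim (fun j => B12Beta.secondMoment (TbalOf Lc Js j) μ ν) := by
  have hLc1 : (1 : ℝ) < (Lc : ℝ) := by exact_mod_cast (lt_of_lt_of_le one_lt_two hLc)
  constructor
  · rintro ⟨N, hD⟩
    rw [(d1Drift_iff_lim_eq Js hall hθ0 hθ1 N).mp hD]
    exact stepBal_nonneg N hLc1.le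
  · intro hℓ
    exact ⟨_, (d1Drift_iff_lim_eq Js hall hθ0 hθ1 _).mpr (stepBal_sqrt_eq hLc1 hℓ).symm⟩

/-- [folklore] **… (D1) for a NONNEGATIVE numeral `N` ⟺ `0 ≤ lim β⁰ ∧ N = √(12π²·lim β⁰∕(11·log Lc))`** (any `Js` under the rate). -/
theorem d1Drift_iff_eq_sqrt_of_allScales (hLc : 2 ≤ Lc) (Js : ℕ → JetData 3 Lc) {μ ν : Fin 4} {κ θ : ℝ}
    (hall : AllScalesSeq (fun j => B12Beta.secondMoment (TbalOf Lc Js j) μ ν) κ θ) (hθ0 : 0 ≤ θ) (hθ1 : θ < 1) {N : ℝ} (hN : 0 ≤ N) :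
    D1Drift Lc Js N μ ν ↔
      0 ≤ CauchyRate.lim (fun j => B12Beta.secondMoment (TbalOf Lc Js j) μ ν) ∧
        N = Real.sqrt (12 * π ^ 2 * CauchyRate.lim (fun j => B12Beta.secondMoment (TbalOf Lc Js j) μ ν) / (11 * Real.log Lc)) := by
  have hLc1 : (1 : ℝ) < (Lc : ℝ) := by exact_mod_cast (lt_of_lt_of_le one_lt_two hLc)
  constructor
  · intro hD
    have hlim := (d1Drift_iff_lim_eq Js hall hθ0 hθ1 N).mp hD
    refine ⟨?_, eq_sqrt_of_stepBal_eq hLc1 hN hlim.symm⟩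
    rw [hlim]
    exact stepBal_nonneg N hLc1.le
  · rintro ⟨hℓ, hNeq⟩
    rw [hNeq]
    exact (d1Drift_iff_lim_eq Js hall hθ0 hθ1 _).mpr (stepBal_sqrt_eq hLc1 hℓ).symm

/-- [folklore] **… uniqueness of the numeral** (any `Js` under the rate): `0 ≤ lim β⁰ → ∃! N, 0 ≤ N ∧ D1Drift Lc Js N μ ν`. -/
theorem existsUnique_numeral_of_allScales (hLc : 2 ≤ Lc) (Js : ℕ → JetData 3 Lc) {μ ν : Fin 4} {κ θ : ℝ}
    (hall : AllScalesSeq (fun j => B12Beta.secondMoment (TbalOf Lc Js j) μ ν) κ θ) (hθ0 : 0 ≤ θ) (hθ1 : θ < 1)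
    (hℓ : 0 ≤ CauchyRate.lim (fun j => B12Beta.secondMoment (TbalOf Lc Js j) μ ν)) :
    ∃! N : ℝ, 0 ≤ N ∧ D1Drift Lc Js N μ ν := by
  refine ⟨_, ⟨Real.sqrt_nonneg _, ((d1Drift_iff_eq_sqrt_of_allScales hLc Js hall hθ0 hθ1 (Real.sqrt_nonneg _)).mpr ⟨hℓ, rfl⟩)⟩, ?_⟩
  rintro N ⟨hN, hD⟩
  exact ((d1Drift_iff_eq_sqrt_of_allScales hLc Js hall hθ0 hθ1 hN).mp hD).2

/-- [folklore] **… and the SIGN bit: `(∃ N > 0, D1Drift Lc Js N μ ν) ↔ 0 < lim β⁰`** (any `Js` under the rate; `→` is asym1's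
`CauchyRate.lim_pos_of_drift_stepBal`). -/
theorem exists_pos_numeral_iff_lim_pos_of_allScales (hLc : 2 ≤ Lc) (Js : ℕ → JetData 3 Lc) {μ ν : Fin 4} {κ θ : ℝ}
    (hall : AllScalesSeq (fun j => B12Beta.secondMoment (TbalOf Lc Js j) μ ν) κ θ) (hθ0 : 0 ≤ θ) (hθ1 : θ < 1) :
    (∃ N : ℝ, 0 < N ∧ D1Drift Lc Js N μ ν) ↔ 0 < CauchyRate.lim (fun j => B12Beta.secondMoment (TbalOf Lc Js j) μ ν) := by
  have hLc1 : (1 : ℝ) < (Lc : ℝ) := by exact_mod_cast (lt_of_lt_of_le one_lt_two hLc)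
  constructor
  · rintro ⟨N, hN, ⟨A, hA⟩⟩
    exact hall.cauchyRate.lim_pos_of_drift_stepBal hθ1 hA hN hLc1
  · intro hℓ
    refine ⟨_, ?_, (d1Drift_iff_lim_eq Js hall hθ0 hθ1 _).mpr (stepBal_sqrt_eq hLc1 hℓ.le).symm⟩
    have hlog : 0 < Real.log (Lc : ℝ) := Real.log_pos hLc1
    exact Real.sqrt_pos.mpr (by positivity)

end AnyJs

end

end Summit.QuantumFields.BalabanUV.Gaps.D1PinnedNumeral
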